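/-
Copyright: the b2b-balaban T⁴-continuum CRUX team, row NE7b leaf lineage `t4-ne7b-formalise-leaf-06` (gen 161). Project licence.
-/
import Summits.QuantumFields.BalabanUV.T4Continuum.Spine.NE7b.SupEquationTower

/-!
# TWO LETTERS OF THE EQUATION-MAP TOWER's COMPOSITE TRANSPORT: the COMPOSITE LIFT IDENTITY `Eq₀(Φ_k w) = (Lp_0∘⋯∘Lp_{k−1})(Eq_k w)`
# — the fine equation at the `k`-times transported background IS the `k`-fold lift of the level-`k` effective equation — and the
# LINEARISATION `DΦ_k(0) = 𝒮_k` — the admissible section the level-`k` chart is read on is the derivative of the composite transport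
# (row NE7b, node U5c; bookkeeping over `…SupEquationTower.tower_eq`'s exported letters; [folklore]; any Banach currencies)

Cell `pub-balaban`, sub-cell `t4`, spine estimate NE7b (`T4WeightBudget.RelWeightBound`; the cell's OWN estimate — NOT PRINTED in
[Bałaban 1983–89], NOT PROVED).  Crux-route work under `Spine/NE7b/` by a row leaf (`t4-ne7b-formalise-leaf-06` gen 161) under FREEZE
(0)'s crux-prover clause; NOTHING of Bałaban's is named as a Lean object, valued or asserted; no `T4Continuum/Support` leaf typed; no
`def`; zero `sorry`.  Import: this lineage's `…SupEquationTower` (TOWER; through it STEP and SIS).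

WHY (located).  TOWER exports, at every level, the ONE-STEP lift `Eq_k(σ_k w) = Lp_k(Eq_{k+1} w)` and the recursion `Φ_{k+1} = Φ_k∘σ_k`;
what a reader of the fine action wants is the COMPOSITE statement — with the composite lifts `ℒ_0 = 1`, `ℒ_{k+1} = ℒ_k∘Lp_k` (user data,
like the composite blockings `𝒬_k`): `Eq₀(Φ_k w) = ℒ_k(Eq_k w)` on `closedBall 0 r_k`, so that `Eq_k w = 0` forces `Eq₀(Φ_k w) = 0` (TOWER's
lift) AND, when `𝒬_k∘ℒ_k = 1`, conversely `Eq_k w = 𝒬_k(Eq₀(Φ_k w))` — the level-`k` equation map IS the coarse image of the fine one at the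
transported background.  Second, TOWER names `𝒮_k` «the linearised composite section» and reads the level-`k` chart on it; here the name is
earned: `Φ_k` is differentiable at `0` with `DΦ_k(0) = 𝒮_k` (chain rule along `Φ_{k+1} = Φ_k∘σ_k`, `σ_k(0) = 0`).  Both are inductions over
the exported letters ONLY — stated abstractly (§1, §2) so that any producer of the letters (TOWER, its constant-blocking corollary, a
future weighted tower) feeds them, then instantiated on `tower_eq` (§3).

WHAT IS PROVED ([folklore]; `X : ℕ → Type`, real normed spaces):
* §1 **`composite_lift_of_letters`** — families `σ Eq Φ Lp ℒ` with `Φ 0 = id`, `Φ (k+1) = Φ k∘σ k`, `ℒ 0 = 1`, `ℒ (k+1) = ℒ k∘Lp k`, radii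
  `r` with `σ_k(closedBall 0 r_{k+1}) ⊆ closedBall 0 r_k` and the one-step lift on `closedBall 0 r_{k+1}` ⟹ `Eq 0 (Φ k w) = ℒ k (Eq k w)` on
  `closedBall 0 r_k`; `eq_coarse_of_composite_lift` — if moreover `𝒬_k∘ℒ_k = 1` then `Eq k w = 𝒬 k (Eq 0 (Φ k w))`.
* §2 **`hasFDerivAt_composite_of_letters`** — `Φ` as above, `σ k 0 = 0`, `σ k` differentiable at `0`, `𝒮 0 = 1`,
  `𝒮 (k+1) = 𝒮 k∘Dσ_k(0)` ⟹ `HasFDerivAt (Φ k) (𝒮 k) 0` for every `k`.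
* §3 **`tower_eq_compositeLetters`** — `tower_eq`'s hypotheses + composite lifts `ℒ` ⟹ `∃ σ Eq Eq′ 𝒮 Φ` with TOWER's recursion equations,
  its composite letters (C), AND `Eq₀(Φ k w) = ℒ k (Eq k w)` on `closedBall 0 r_k`, AND `HasFDerivAt (Φ k) (𝒮 k) 0`.
* §4 toy (`example`).

NOT HERE (honest): everything TOWER lists (charts by value, control of the displayed recursions, the `ℓ^∞` instance, (A3) ∕ (A1c));
the identification `Φ_k =` the ONE-SHOT branch of the composite blocking (leaf-04's `…SupEquationTowerSemigroup` does `k = 2`); anything of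
Bałaban's.  BY-NAME EFFECT ON THE WALL: NONE.  NE7b NOT PRINTED ∕ NOT PROVED; spine PROVED 0∕9; rung (B)+1 on a FINITE torus — NOT infinite
volume, NOT the mass gap, NOT Clay.  HONEST DEPENDENCY: continuum YM on T⁴ ⇐ BetaPertH ∧ nine spine estimates (0∕9 proved); BetaPertH ⇐ (D1)
∧ (D4) ∧ CAP+tail; G-an2-4 gates asym, D1 and NE2∕3∕4.
-/

set_option autoImplicit false

noncomputable section

namespace Summit.QuantumFields.BalabanUV.T4Continuum.NE7b.SupEquationTowerLetters

open Set Metric Function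
open scoped NNReal
open Summit.QuantumFields.BalabanUV.T4Continuum.NE7b

variable {X : ℕ → Type*} {K : ℕ → Type*} [∀ k, NormedAddCommGroup (X k)] [∀ k, NormedSpace ℝ (X k)]
  [∀ k, NormedAddCommGroup (K k)] [∀ k, NormedSpace ℝ (K k)]

/-! ## §1. The composite lift identity -/

/-- **THE COMPOSITE LIFT IDENTITY** from the one-step letters: `Eq 0 (Φ k w) = ℒ k (Eq k w)` on `closedBall 0 r_k`, where `ℒ_0 = 1`,
`ℒ_{k+1} = ℒ_k∘Lp_k`. [folklore] -/
theorem composite_lift_of_letters (σ : ∀ k, X (k + 1) → X k) (Eq : ∀ k, X k → X k) (Φ : ∀ k, X k → X 0)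
    (Lp : ∀ k, X (k + 1) →L[ℝ] X k) (ℒ : ∀ k, X k →L[ℝ] X 0)
    (hΦ0 : Φ 0 = id) (hΦ : ∀ k, Φ (k + 1) = Φ k ∘ σ k)
    (hℒ0 : ℒ 0 = ContinuousLinearMap.id ℝ (X 0)) (hℒ : ∀ k, ℒ (k + 1) = (ℒ k).comp (Lp k))
    {r : ℕ → ℝ} (hmaps : ∀ k, ∀ w ∈ closedBall (0 : X (k + 1)) (r (k + 1)), σ k w ∈ closedBall (0 : X k) (r k))
    (hlift : ∀ k, ∀ w ∈ closedBall (0 : X (k + 1)) (r (k + 1)), Eq k (σ k w) = Lp k (Eq (k + 1) w)) :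
    ∀ k, ∀ w ∈ closedBall (0 : X k) (r k), Eq 0 (Φ k w) = ℒ k (Eq k w) := by
  intro k
  induction k with
  | zero => intro w _; rw [hΦ0, hℒ0]; rfl
  | succ k ih =>
    intro w hw
    rw [hΦ k, hℒ k, Function.comp_apply, ih _ (hmaps k w hw), hlift k w hw, ContinuousLinearMap.comp_apply]

/-- … hence, when the composite lift is a section of the composite blocking (`𝒬_k∘ℒ_k = 1`), THE LEVEL-`k` EQUATION MAP IS THE COARSE
IMAGE OF THE FINE ONE AT THE TRANSPORTED BACKGROUND: `Eq k w = 𝒬 k (Eq 0 (Φ k w))`. [folklore] -/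
theorem eq_coarse_of_composite_lift (Eq : ∀ k, X k → X k) (Φ : ∀ k, X k → X 0) (ℒ : ∀ k, X k →L[ℝ] X 0)
    (𝒬 : ∀ k, X 0 →L[ℝ] X k) (h𝒬ℒ : ∀ k, (𝒬 k).comp (ℒ k) = ContinuousLinearMap.id ℝ (X k)) {r : ℕ → ℝ}
    (hcl : ∀ k, ∀ w ∈ closedBall (0 : X k) (r k), Eq 0 (Φ k w) = ℒ k (Eq k w))
    (k : ℕ) {w : X k} (hw : w ∈ closedBall (0 : X k) (r k)) : Eq k w = 𝒬 k (Eq 0 (Φ k w)) := by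
  rw [hcl k w hw, ← ContinuousLinearMap.comp_apply, h𝒬ℒ k]; rfl

/-! ## §2. The linearised composite section is the derivative of the composite transport -/

/-- **`DΦ_k(0) = 𝒮_k`**: with `Φ 0 = id`, `Φ (k+1) = Φ k∘σ k`, `σ k 0 = 0`, `σ k` differentiable at `0`, `𝒮 0 = 1`,
`𝒮 (k+1) = 𝒮 k∘Dσ_k(0)`: `HasFDerivAt (Φ k) (𝒮 k) 0` for every `k` (chain rule). [folklore] -/
theorem hasFDerivAt_composite_of_letters (σ : ∀ k, X (k + 1) → X k) (Φ : ∀ k, X k → X 0) (𝒮 : ∀ k, X k →L[ℝ] X 0)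
    (hΦ0 : Φ 0 = id) (hΦ : ∀ k, Φ (k + 1) = Φ k ∘ σ k) (hσ0 : ∀ k, σ k 0 = 0) (hσd : ∀ k, DifferentiableAt ℝ (σ k) 0)
    (h𝒮0 : 𝒮 0 = ContinuousLinearMap.id ℝ (X 0)) (h𝒮 : ∀ k, 𝒮 (k + 1) = (𝒮 k).comp (fderiv ℝ (σ k) 0)) :
    ∀ k, HasFDerivAt (Φ k) (𝒮 k) 0 := by
  intro k
  induction k with
  | zero => rw [hΦ0, h𝒮0]; exact hasFDerivAt_id (0 : X 0)
  | succ k ih =>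
    rw [hΦ k, h𝒮 k]
    have h1 : HasFDerivAt (Φ k) (𝒮 k) (σ k 0) := by rw [hσ0 k]; exact ih
    exact h1.comp 0 (hσd k).hasFDerivAt

/-! ## §3. On the tower -/

/-- **THE TOWER WITH ITS COMPOSITE LETTERS**: `tower_eq`'s hypotheses and composite lifts `ℒ_0 = 1`, `ℒ_{k+1} = ℒ_k∘Lp_k` ⟹ the tower's
families with the recursion equations, the composite letters (C), THE COMPOSITE LIFT `Eq₀(Φ k w) = ℒ k (Eq k w)` on `closedBall 0 r_k`, and
`HasFDerivAt (Φ k) (𝒮 k) 0`. [folklore] -/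
theorem tower_eq_compositeLetters [∀ k, CompleteSpace (X k)] [∀ k, Nontrivial (X k)]
    (Q : ∀ k, X k →L[ℝ] X (k + 1)) (Lp : ∀ k, X (k + 1) →L[ℝ] X k) (P : ∀ k, X k →L[ℝ] K k) (ι : ∀ k, K k →L[ℝ] X k)
    (hPι : ∀ k h, ι k (P k h) = h - Lp k (Q k h)) {CP : ℕ → ℝ} (hCP : ∀ k, ‖P k‖ ≤ CP k)
    (𝒬 : ∀ k, X 0 →L[ℝ] X k) (h𝒬0 : 𝒬 0 = ContinuousLinearMap.id ℝ (X 0)) (h𝒬 : ∀ k, 𝒬 (k + 1) = (Q k).comp (𝒬 k))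
    (ℒ : ∀ k, X k →L[ℝ] X 0) (hℒ0 : ℒ 0 = ContinuousLinearMap.id ℝ (X 0)) (hℒ : ∀ k, ℒ (k + 1) = (ℒ k).comp (Lp k))
    {Eq₀ : X 0 → X 0} {Eq₀' : X 0 → X 0 →L[ℝ] X 0} (hE0 : Eq₀ 0 = 0)
    {r B M : ℕ → ℝ} (hr0 : ∀ k, 0 ≤ r k) (hM0 : ∀ k, 0 ≤ M k)
    (hE : ∀ x ∈ closedBall (0 : X 0) (r 0), HasFDerivAt Eq₀ (Eq₀' x) x)
    (hB : ∀ x ∈ closedBall (0 : X 0) (r 0), ‖Eq₀' x‖ ≤ B 0)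
    (hM : ∀ x ∈ closedBall (0 : X 0) (r 0), ∀ x' ∈ closedBall (0 : X 0) (r 0), ‖Eq₀' x - Eq₀' x'‖ ≤ M 0 * ‖x - x'‖)
    (T : ∀ k, X k ≃L[ℝ] X (k + 1) × K k) {N c : ℕ → ℝ≥0}
    (hT : ∀ k (𝒮 : X k →L[ℝ] X 0), (𝒬 k).comp 𝒮 = ContinuousLinearMap.id ℝ (X k) →
      (∀ j, j < k → ∀ h, P j (𝒬 j (Eq₀' 0 (𝒮 h))) = 0) → ∀ h, T k h = (Q k h, P k (𝒬 k (Eq₀' 0 (𝒮 h)))))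
    (hN : ∀ k (y : X (k + 1) × K k), ‖(T k).symm y‖ ≤ N k * ‖y‖) (hcN : ∀ k, c k < (N k)⁻¹)
    (hc : ∀ k, CP k * M k * r k ≤ (c k : ℝ)) (hr : ∀ k, r (k + 1) < ((N k : ℝ)⁻¹ - c k) * r k)
    (hBs : ∀ k, ‖Q k‖ * B k * ((N k : ℝ)⁻¹ - c k)⁻¹ ≤ B (k + 1))
    (hMs : ∀ k, ‖Q k‖ * (M k * ((N k : ℝ)⁻¹ - c k)⁻¹ * ((N k : ℝ)⁻¹ - c k)⁻¹ +
      B k * ((((N k : ℝ)⁻¹ - c k)⁻¹) ^ 2 * (CP k * M k) * ((N k : ℝ)⁻¹ - c k)⁻¹)) ≤ M (k + 1)) :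
    ∃ (σ : ∀ k, X (k + 1) → X k) (Eq : ∀ k, X k → X k) (Eq' : ∀ k, X k → X k →L[ℝ] X k) (𝒮 : ∀ k, X k →L[ℝ] X 0)
      (Φ : ∀ k, X k → X 0),
      Eq 0 = Eq₀ ∧ Eq' 0 = Eq₀' ∧ 𝒮 0 = ContinuousLinearMap.id ℝ (X 0) ∧ Φ 0 = id ∧
      (∀ k, Eq (k + 1) = fun w => Q k (Eq k (σ k w))) ∧
      (∀ k, Eq' (k + 1) = fun w => (Q k).comp ((Eq' k (σ k w)).comp (fderiv ℝ (σ k) w))) ∧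
      (∀ k, 𝒮 (k + 1) = (𝒮 k).comp (fderiv ℝ (σ k) 0)) ∧
      (∀ k, Φ (k + 1) = Φ k ∘ σ k) ∧
      (∀ k, Φ k 0 = 0 ∧ (∀ w ∈ closedBall (0 : X k) (r k), Φ k w ∈ closedBall (0 : X 0) (r 0)) ∧
        (∀ w ∈ closedBall (0 : X k) (r k), 𝒬 k (Φ k w) = w) ∧
        LipschitzOnWith (∏ j ∈ Finset.range k, ((N j)⁻¹ - c j)⁻¹) (Φ k) (closedBall (0 : X k) (r k)) ∧
        (∀ w ∈ closedBall (0 : X k) (r k), Eq k w = 0 → Eq₀ (Φ k w) = 0)) ∧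
      -- the two composite letters of this file
      (∀ k, ∀ w ∈ closedBall (0 : X k) (r k), Eq₀ (Φ k w) = ℒ k (Eq k w)) ∧
      (∀ k, HasFDerivAt (Φ k) (𝒮 k) 0) := by
  obtain ⟨σ, Eq, Eq', 𝒮, Φ, hE0', hE0'', h𝒮0, hΦ0, hEs, hE's, h𝒮s, hΦs, -, hBr, hC⟩ :=
    SupEquationTower.tower_eq Q Lp P ι hPι hCP 𝒬 h𝒬0 h𝒬 hE0 hr0 hM0 hE hB hM T hT hN hcN hc hr hBs hMs
  -- the next radius sits inside the chart balls
  have hsub : ∀ k, closedBall (0 : X (k + 1)) (r (k + 1)) ⊆ closedBall (0 : X (k + 1)) (((N k : ℝ)⁻¹ - c k) * r k) :=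
    fun k => closedBall_subset_closedBall (hr k).le
  have hρpos : ∀ k, (0 : X (k + 1)) ∈ ball (0 : X (k + 1)) (((N k : ℝ)⁻¹ - c k) * r k) :=
    fun k => mem_ball_self (lt_of_le_of_lt (hr0 (k + 1)) (hr k))
  have hmaps : ∀ k, ∀ w ∈ closedBall (0 : X (k + 1)) (r (k + 1)), σ k w ∈ closedBall (0 : X k) (r k) :=
    fun k w hw => ((hBr k).2.1 w (hsub k hw)).1
  have hlift : ∀ k, ∀ w ∈ closedBall (0 : X (k + 1)) (r (k + 1)), Eq k (σ k w) = Lp k (Eq (k + 1) w) :=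
    fun k w hw => ((hBr k).2.1 w (hsub k hw)).2.2.2
  have hcl := composite_lift_of_letters σ Eq Φ Lp ℒ hΦ0 hΦs hℒ0 hℒ hmaps hlift
  refine ⟨σ, Eq, Eq', 𝒮, Φ, hE0', hE0'', h𝒮0, hΦ0, hEs, hE's, h𝒮s, hΦs, hC, fun k w hw => ?_, ?_⟩
  · rw [← hE0']; exact hcl k w hw
  · exact hasFDerivAt_composite_of_letters σ Φ 𝒮 hΦ0 hΦs (fun k => (hBr k).1)
      (fun k => ((hBr k).2.2.2.2 0 (hρpos k)).1) h𝒮0 h𝒮s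

/-! ## §4. Toy -/

/-- Toy: the composite lift on the constant tower `X k = ℝ` with `σ = Φ = id`, `Eq k = id`, `Lp = ℒ = 1`: `Eq₀(Φ_k w) = ℒ_k(Eq_k w)` reads `w = w`. -/
example : ∀ k, ∀ w ∈ closedBall (0 : ℝ) ((fun _ : ℕ => (1 : ℝ)) k),
    (fun (_ : ℕ) (x : ℝ) => x) 0 ((fun (_ : ℕ) (x : ℝ) => x) k w)
      = (fun _ : ℕ => ContinuousLinearMap.id ℝ ℝ) k ((fun (_ : ℕ) (x : ℝ) => x) k w) :=
  composite_lift_of_letters (X := fun _ => ℝ) (fun _ => id) (fun _ x => x) (fun _ x => x) (fun _ => ContinuousLinearMap.id ℝ ℝ)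
    (fun _ => ContinuousLinearMap.id ℝ ℝ) rfl (fun _ => rfl) rfl (fun _ => rfl) (r := fun _ => 1) (fun _ _ hw => hw) (fun _ _ _ => rfl)

end Summit.QuantumFields.BalabanUV.T4Continuum.NE7b.SupEquationTowerLetters

end
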